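import Mathlib
import Literature.Analysis.FluidPDE.SereginSverakPressureProofs
import Literature.Analysis.FluidPDE.NSSereginDecayWeightedCubic
import Literature.Analysis.FunctionSpaces.SobolevTraceDensityProofs
import Summits.NavierStokesRegularity.NavierStokesRegularity.Theorems.EulerZoomLiouvillePowerGaugeEulerLiouvilleEnergySaturationCutoff
import HarnessLib

/-!
# Energy saturation on rung C1 of the crux `EulerZoomLiouville.PowerGaugeEulerLiouville`, III:
# the cubic integral on balls through the normalised energy (gauges `A`, `E`)
# (crux = stmt-NavierStokesRegularity-19832, route №10 `EulerZoomLiouville`, line `birth`)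

Seat `ns-ezl-19832-w2` (stub-worker under the crux lead `ns-ezl-19832-p1`), cell ns-regularity-ideate.

For the profile `V` of an exactly self-similar member of Seregin's power-gauged ancient Euler class
the lineage's dictionary (`…SelfSimilarGauges/Gradient/Pressure`, packaged in
`rungC1_of_profileLiouville_full`) reads the three gauges as

* (A) `∫_{B_L} |V|² ≤ c L^{1−2ρ}` (every `L > 0`),
* (E) `∫ |∇V|²_F |y|^{ρ−1} ≤ ((1−ρ)/(2+ρ)) c`,
* (D) `∫ |P|^{3/2} |y|^{2ρ−2} ≤ ((2−2ρ)/(2+ρ)) c`.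

This file converts (E) and (D) into growth bounds on balls (`lintegral_ball_frobenius_le_of_weight`,
`lintegral_ball_pressure_le_of_weight`: `∫_{B_L}|∇V|²_F ≤ ((1−ρ)/(2+ρ)) c L^{1−ρ}`,
`∫_{B_L}|P|^{3/2} ≤ ((2−2ρ)/(2+ρ)) c L^{2−2ρ}`) and proves the CUBIC BALL BOUND THROUGH THE NORMALISED
ENERGY (`lintegral_ball_cube_le`, real form `setIntegral_ball_cube_le`): for a cut-off `σ` as in
`exists_radialCutoff` (`σ = 1` on `B̄₁`, `0` off `B₂`, `0 ≤ σ ≤ 1`, `‖Dσ‖ ≤ M`) and `R ≥ 1`,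

  `∫_{B_R} |V|³ ≤ K^{3/2} · (∫ σ(R⁻¹y)|V|²)^{3/4} · (C_G R^{1−ρ})^{3/4}`,
  `C_G = 2·3^{1−ρ}·((1−ρ)/(2+ρ))c + 6 M² 3^{1−2ρ} c`,

`K` Mathlib's Gagliardo–Nirenberg–Sobolev constant — i.e. `∫_{B_R}|V|³ ≲ N_σ(R)^{3/4} R^{(6−9ρ)/4}` with
the normalised energy `N_σ(R) = R^{2ρ−1}∫σ(R⁻¹y)|V|²` of `…EnergySaturationIdentity`.  Proof: the
localised field `w = σ(R⁻¹·) V` has weak gradient `σ_R ∇V + Dσ_R ⊗ V` (`hasWeakFDerivOn_smul`),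
`∫|w|² ≤ ∫σ_R|V|²`, `∫|∇w|²_F ≤ 2∫_{B_{3R}}|∇V|²_F + 6(M/R)²∫_{B_{3R}}|V|² ≤ C_G R^{1−ρ}`, and the tree's
whole-space interpolation–Sobolev bound `∫|w|³ ≤ (∫|w|²)^{3/4} K^{3/2} (∫|∇w|²_F)^{3/4}`
(`SereginSverak2002.lintegral_enorm_pow_three_le_of_hasWeakGradient`).  The point of the exponent
`3/4` on the energy: in the saturation bootstrap (sequel) the cubic flux through the shells IMPROVES with
the normalised energy, which a fixed cubic gauge bound would not give.

WHAT THIS IS NOT: not NS regularity, not the crux, not rung C1 — a shell estimate serving the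
energy-saturation stratum (Bronzi–Shvydkoy 2015 Thm 1.1 in the weak class); `--supports` stmt-19832.
[folklore]
-/

noncomputable section

set_option linter.dupNamespace false

open MeasureTheory Set Filter Topology Metric Function TopologicalSpace
open scoped ENNReal NNReal RealInnerProductSpace ContDiff

namespace Summit.NavierStokesRegularity.NavierStokesRegularity.Theorems.PowerGaugeEulerLiouville

open Literature.Analysis Literature.Analysis.FunctionSpaces Literature.Analysis.FluidPDE

namespace EnergySaturation

/-! ## Growth on balls from the weighted gauges -/

section Growth

variable {ρ : ℝ} {V : EuclideanSpace ℝ (Fin 3) → EuclideanSpace ℝ (Fin 3)}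
  {P : EuclideanSpace ℝ (Fin 3) → ℝ}
  {G : EuclideanSpace ℝ (Fin 3) → EuclideanSpace ℝ (Fin 3) →L[ℝ] EuclideanSpace ℝ (Fin 3)}

/-- Lebesgue-almost every point of `ℝ³` is nonzero. [folklore] -/
theorem ae_ne_zero : ∀ᵐ y ∂(volume : Measure (EuclideanSpace ℝ (Fin 3))), y ≠ 0 := by
  rw [ae_iff]
  simp only [ne_eq, not_not, setOf_eq_eq_singleton, measure_singleton]

/-- On the ball `B_L` the weight `|y|^{q}` with `q ≤ 0` is at least `L^{q}` (a.e., `y ≠ 0`), so a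
weighted bound `∫ f |y|^q ≤ C` gives the growth bound `∫_{B_L} f ≤ L^{−q} C`. [folklore] -/
theorem lintegral_ball_le_of_weight {f : EuclideanSpace ℝ (Fin 3) → ℝ≥0∞}
    {q : ℝ} (hq : q ≤ 0) {C : ℝ≥0∞}
    (hC : ∫⁻ y, f y * ENNReal.ofReal (‖y‖ ^ q) ≤ C) {L : ℝ} (hL : 0 < L) :
    ∫⁻ y in ball (0 : EuclideanSpace ℝ (Fin 3)) L, f y ≤ ENNReal.ofReal (L ^ (-q)) * C := by
  have hkey : ∫⁻ y in ball (0 : EuclideanSpace ℝ (Fin 3)) L, f y ≤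
      ∫⁻ y, f y * ENNReal.ofReal (‖y‖ ^ q) * ENNReal.ofReal (L ^ (-q)) := by
    rw [← lintegral_indicator measurableSet_ball]
    refine lintegral_mono_ae ?_
    filter_upwards [ae_ne_zero] with y hy
    by_cases hyB : y ∈ ball (0 : EuclideanSpace ℝ (Fin 3)) L
    · rw [indicator_of_mem hyB]
      have hy0 : 0 < ‖y‖ := norm_pos_iff.2 hy
      rw [mem_ball, dist_zero_right] at hyB
      -- `1 ≤ |y|^q L^{-q}`
      have hw : (1 : ℝ≥0∞) ≤ ENNReal.ofReal (‖y‖ ^ q) * ENNReal.ofReal (L ^ (-q)) := by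
        rw [← ENNReal.ofReal_mul (Real.rpow_nonneg hy0.le _), ← ENNReal.ofReal_one]
        refine ENNReal.ofReal_le_ofReal ?_
        rw [Real.rpow_neg hL.le, ← div_eq_mul_inv, le_div_iff₀ (Real.rpow_pos_of_pos hL _), one_mul]
        exact Real.rpow_le_rpow_of_nonpos hy0 hyB.le hq
      calc f y = f y * 1 := (mul_one _).symm
        _ ≤ f y * (ENNReal.ofReal (‖y‖ ^ q) * ENNReal.ofReal (L ^ (-q))) := by gcongr
        _ = f y * ENNReal.ofReal (‖y‖ ^ q) * ENNReal.ofReal (L ^ (-q)) := by ring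
    · rw [indicator_of_notMem hyB]; exact zero_le
  rw [lintegral_mul_const' _ _ ENNReal.ofReal_ne_top] at hkey
  calc ∫⁻ y in ball (0 : EuclideanSpace ℝ (Fin 3)) L, f y
      ≤ (∫⁻ y, f y * ENNReal.ofReal (‖y‖ ^ q)) * ENNReal.ofReal (L ^ (-q)) := hkey
    _ ≤ C * ENNReal.ofReal (L ^ (-q)) := by gcongr
    _ = ENNReal.ofReal (L ^ (-q)) * C := mul_comm _ _

/-- **Gradient growth on balls from the `E`-weight**: `∫ |∇V|²_F |y|^{ρ−1} ≤ C` (`ρ < 1`) gives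
`∫_{B_L} |∇V|²_F ≤ L^{1−ρ} C`. [folklore] -/
theorem lintegral_ball_frobenius_le_of_weight (hρ1 : ρ < 1) {C : ℝ≥0∞}
    (hE : ∫⁻ y, ENNReal.ofReal (frobeniusNormSq (G y)) * ENNReal.ofReal (‖y‖ ^ (ρ - 1)) ≤ C)
    {L : ℝ} (hL : 0 < L) :
    ∫⁻ y in ball (0 : EuclideanSpace ℝ (Fin 3)) L, ENNReal.ofReal (frobeniusNormSq (G y)) ≤
      ENNReal.ofReal (L ^ (1 - ρ)) * C := by
  have h := lintegral_ball_le_of_weight (by linarith : ρ - 1 ≤ 0) hE hL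
  rwa [show -(ρ - 1) = 1 - ρ by ring] at h

/-- **Pressure growth on balls from the `D`-weight**: `∫ |P|^{3/2} |y|^{2ρ−2} ≤ C` (`ρ < 1`) gives
`∫_{B_L} |P|^{3/2} ≤ L^{2−2ρ} C`. [folklore] -/
theorem lintegral_ball_pressure_le_of_weight (hρ1 : ρ < 1) {C : ℝ≥0∞}
    (hD : ∫⁻ y, ‖P y‖ₑ ^ (3 / 2 : ℝ) * ENNReal.ofReal (‖y‖ ^ (2 * ρ - 2)) ≤ C)
    {L : ℝ} (hL : 0 < L) :
    ∫⁻ y in ball (0 : EuclideanSpace ℝ (Fin 3)) L, ‖P y‖ₑ ^ (3 / 2 : ℝ) ≤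
      ENNReal.ofReal (L ^ (2 - 2 * ρ)) * C := by
  have h := lintegral_ball_le_of_weight (by linarith : 2 * ρ - 2 ≤ 0) hD hL
  rwa [show -(2 * ρ - 2) = 2 - 2 * ρ by ring] at h

/-- `V ∈ L²(B_L)` from the `A`-growth (finite energy on balls). [folklore] -/
theorem memLp_two_ball_of_growth (hVm : AEStronglyMeasurable V volume) {c : ℝ≥0}
    (hA : ∀ L : ℝ, 0 < L → ∫⁻ y in ball (0 : EuclideanSpace ℝ (Fin 3)) L, ‖V y‖ₑ ^ 2 ≤
      (c : ℝ≥0∞) * ENNReal.ofReal (L ^ (1 - 2 * ρ))) {L : ℝ} (hL : 0 < L) :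
    MemLp V 2 (volume.restrict (ball (0 : EuclideanSpace ℝ (Fin 3)) L)) := by
  refine ⟨hVm.restrict, ?_⟩
  rw [eLpNorm_lt_top_iff_lintegral_rpow_enorm_lt_top two_ne_zero ENNReal.ofNat_ne_top]
  have e : ∀ y, ‖V y‖ₑ ^ (2 : ℝ≥0∞).toReal = ‖V y‖ₑ ^ 2 := fun y => by
    rw [ENNReal.toReal_ofNat, ENNReal.rpow_ofNat]
  simp_rw [e]
  exact lt_of_le_of_lt (hA L hL) (ENNReal.mul_lt_top ENNReal.coe_lt_top ENNReal.ofReal_lt_top)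

/-- `|V|² ∈ L¹_loc` from the `A`-growth. [folklore] -/
theorem locallyIntegrable_norm_sq_of_growth (hVm : AEStronglyMeasurable V volume) {c : ℝ≥0}
    (hA : ∀ L : ℝ, 0 < L → ∫⁻ y in ball (0 : EuclideanSpace ℝ (Fin 3)) L, ‖V y‖ₑ ^ 2 ≤
      (c : ℝ≥0∞) * ENNReal.ofReal (L ^ (1 - 2 * ρ))) :
    LocallyIntegrable (fun y => ‖V y‖ ^ 2) volume := by
  intro x
  refine ⟨ball 0 (‖x‖ + 1), isOpen_ball.mem_nhds (by rw [mem_ball, dist_zero_right]; linarith), ?_⟩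
  exact (memLp_two_iff_integrable_sq_norm hVm.restrict).1
    (memLp_two_ball_of_growth hVm hA (by positivity))

end Growth

/-! ## The cubic integral on a ball through the normalised energy -/

section CubicBall

variable {ρ : ℝ} {σ : EuclideanSpace ℝ (Fin 3) → ℝ}
  {V : EuclideanSpace ℝ (Fin 3) → EuclideanSpace ℝ (Fin 3)}
  {G : EuclideanSpace ℝ (Fin 3) → EuclideanSpace ℝ (Fin 3) →L[ℝ] EuclideanSpace ℝ (Fin 3)}

/-- **The cubic ball bound through the normalised energy (`ℝ≥0∞` form).**  Let `V` have the
whole-space weak gradient `G`, the `A`-growth `∫_{B_L}|V|² ≤ c L^{1−2ρ}` and the `E`-weight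
`∫|G|²_F|y|^{ρ−1} ≤ ((1−ρ)/(2+ρ))c` (`0 < ρ < 1`), and let `σ` be a cut-off with `0 ≤ σ ≤ 1`, `σ = 1` on
`B̄₁`, `σ = 0` off `B₂`, `‖Dσ‖ ≤ M`.  Then for `R ≥ 1`
`∫_{B_R}|V|³ ≤ (∫σ(R⁻¹y)|V|²)^{3/4} · K^{3/2} · (C_G R^{1−ρ})^{3/4}`,
`C_G = 2·3^{1−ρ}((1−ρ)/(2+ρ))c + 6M²3^{1−2ρ}c`, `K` the Gagliardo–Nirenberg–Sobolev constant
(interpolation `‖·‖₃ ≤ ‖·‖₂^{1/2}‖·‖₆^{1/2}` and Sobolev for the localised field `σ(R⁻¹·)V`). [folklore] -/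
theorem lintegral_ball_cube_le (hρ : 0 < ρ) (hρ1 : ρ < 1)
    (hσ : IsTestFunctionOn (⊤ : Opens (EuclideanSpace ℝ (Fin 3))) σ) (h0 : ∀ z, 0 ≤ σ z)
    (h1 : ∀ z, σ z ≤ 1) (hone : ∀ z, ‖z‖ ≤ 1 → σ z = 1) (hzero : ∀ z, 2 ≤ ‖z‖ → σ z = 0)
    {M : ℝ} (hM : ∀ z, ‖fderiv ℝ σ z‖ ≤ M)
    (hVm : AEStronglyMeasurable V volume) (hGm : AEStronglyMeasurable G volume)
    (hVG : HasWeakFDerivOn (⊤ : Opens (EuclideanSpace ℝ (Fin 3))) volume V G) {c : ℝ≥0}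
    (hA : ∀ L : ℝ, 0 < L → ∫⁻ y in ball (0 : EuclideanSpace ℝ (Fin 3)) L, ‖V y‖ₑ ^ 2 ≤
      (c : ℝ≥0∞) * ENNReal.ofReal (L ^ (1 - 2 * ρ)))
    (hE : ∫⁻ y, ENNReal.ofReal (frobeniusNormSq (G y)) * ENNReal.ofReal (‖y‖ ^ (ρ - 1)) ≤
      ENNReal.ofReal ((1 - ρ) / (2 + ρ)) * (c : ℝ≥0∞))
    {R : ℝ} (hR : 1 ≤ R) :
    ∫⁻ y in ball (0 : EuclideanSpace ℝ (Fin 3)) R, ‖V y‖ₑ ^ (3 : ℕ) ≤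
      ENNReal.ofReal (∫ y, σ (R⁻¹ • y) * ‖V y‖ ^ 2) ^ (3 / 4 : ℝ) *
        (((SNormLESNormFDerivOfEqConst (EuclideanSpace ℝ (Fin 3))
            (volume : Measure (EuclideanSpace ℝ (Fin 3))) 2 : ℝ≥0∞) ^ (3 / 2 : ℝ)) *
          ENNReal.ofReal ((2 * (3 : ℝ) ^ (1 - ρ) * ((1 - ρ) / (2 + ρ) * c) +
            6 * M ^ 2 * (3 : ℝ) ^ (1 - 2 * ρ) * c) * R ^ (1 - ρ)) ^ (3 / 4 : ℝ)) := by
  have hR0 : 0 < R := lt_of_lt_of_le one_pos hR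
  have hM0 : 0 ≤ M := (norm_nonneg _).trans (hM 0)
  have hσd : Differentiable ℝ σ := hσ.contDiff.differentiable (by simp)
  have hV2 : LocallyIntegrable (fun y => ‖V y‖ ^ 2) volume := locallyIntegrable_norm_sq_of_growth hVm hA
  -- the localised field and its weak gradient
  set χ : EuclideanSpace ℝ (Fin 3) → ℝ := fun y => σ (R⁻¹ • y) with hχ
  have hχs : ContDiff ℝ ∞ χ := hσ.contDiff.comp (contDiff_const_smul _)
  have hχc : Continuous χ := hχs.continuous
  have hχ01 : ∀ y, 0 ≤ χ y ∧ χ y ≤ 1 := fun y => ⟨h0 _, h1 _⟩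
  have hχzero : ∀ y : EuclideanSpace ℝ (Fin 3), 2 * R ≤ ‖y‖ → χ y = 0 := by
    intro y hy
    apply hzero
    rw [norm_smul, norm_inv, Real.norm_of_nonneg hR0.le, le_inv_mul_iff₀ hR0]
    linarith
  have hχone : ∀ y : EuclideanSpace ℝ (Fin 3), ‖y‖ < R → χ y = 1 := by
    intro y hy
    apply hone
    rw [norm_smul, norm_inv, Real.norm_of_nonneg hR0.le, inv_mul_le_iff₀ hR0]
    linarith
  have hDχ : ∀ y, ‖fderiv ℝ χ y‖ ≤ M / R := by
    intro y
    have e : fderiv ℝ χ y = R⁻¹ • fderiv ℝ σ (R⁻¹ • y) := by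
      ext w; rw [hχ, fderiv_comp_inv_smul_apply hσd]; rfl
    rw [e, norm_smul, norm_inv, Real.norm_of_nonneg hR0.le, div_eq_inv_mul]
    gcongr
    exact hM _
  have hDχzero : ∀ y : EuclideanSpace ℝ (Fin 3), 2 * R ≤ ‖y‖ → fderiv ℝ χ y = 0 := by
    intro y hy
    have hz : ¬ (1 < ‖R⁻¹ • y‖ ∧ ‖R⁻¹ • y‖ < 2) := by
      rw [norm_smul, norm_inv, Real.norm_of_nonneg hR0.le]
      rintro ⟨-, hb⟩
      rw [inv_mul_lt_iff₀ hR0] at hb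
      linarith
    ext w
    rw [hχ, fderiv_comp_inv_smul_apply hσd, fderiv_eq_zero_of_not_mem_shell h0 h1 hone hzero hz]
    simp
  set w : EuclideanSpace ℝ (Fin 3) → EuclideanSpace ℝ (Fin 3) := fun y => χ y • V y with hw
  set Gw : EuclideanSpace ℝ (Fin 3) → EuclideanSpace ℝ (Fin 3) →L[ℝ] EuclideanSpace ℝ (Fin 3) :=
    fun y => χ y • G y + (fderiv ℝ χ y).smulRight (V y) with hGw
  have hwG : HasWeakGradient w Gw := SobolevApprox.hasWeakFDerivOn_smul hVG hχs
  -- the big ball `B_{3R}` contains the supports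
  set B : Set (EuclideanSpace ℝ (Fin 3)) := ball 0 (3 * R) with hB
  have hBm : MeasurableSet B := measurableSet_ball
  have houtB : ∀ y, y ∉ B → χ y = 0 ∧ fderiv ℝ χ y = 0 := by
    intro y hy
    rw [hB, mem_ball, dist_zero_right, not_lt] at hy
    exact ⟨hχzero y (by linarith), hDχzero y (by linarith)⟩
  -- `w ∈ L²`
  have hV2B : MemLp V 2 (volume.restrict B) := memLp_two_ball_of_growth hVm hA (by positivity)
  have hw2 : MemLp w 2 volume := by
    have hind : MemLp (B.indicator V) 2 volume := (memLp_indicator_iff_restrict hBm).2 hV2B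
    refine hind.of_le (hχc.aestronglyMeasurable.smul hVm) (Eventually.of_forall fun y => ?_)
    show ‖χ y • V y‖ ≤ ‖B.indicator V y‖
    by_cases hy : y ∈ B
    · rw [indicator_of_mem hy, norm_smul, Real.norm_of_nonneg (hχ01 y).1]
      exact mul_le_of_le_one_left (norm_nonneg _) (hχ01 y).2
    · rw [(houtB y hy).1, zero_smul, norm_zero]; exact norm_nonneg _
  -- `∫|w|² ≤ ∫ χ|V|²`
  have hint : Integrable (fun y => χ y * ‖V y‖ ^ 2) volume := by
    have := hV2.integrable_smul_left_of_hasCompactSupport hχc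
      (hσ.hasCompactSupport.comp_smul (inv_ne_zero hR0.ne'))
    simpa only [smul_eq_mul] using this
  have hAw : ∫⁻ y, ‖w y‖ₑ ^ 2 ≤ ENNReal.ofReal (∫ y, χ y * ‖V y‖ ^ 2) := by
    rw [ofReal_integral_eq_lintegral_ofReal hint
      (Eventually.of_forall fun y => mul_nonneg (hχ01 y).1 (sq_nonneg _))]
    refine lintegral_mono fun y => ?_
    show ‖χ y • V y‖ₑ ^ 2 ≤ ENNReal.ofReal (χ y * ‖V y‖ ^ 2)
    rw [← ofReal_norm, ← ENNReal.ofReal_pow (norm_nonneg _)]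
    refine ENNReal.ofReal_le_ofReal ?_
    rw [norm_smul, Real.norm_of_nonneg (hχ01 y).1, mul_pow]
    have : χ y ^ 2 ≤ χ y := by nlinarith [(hχ01 y).1, (hχ01 y).2]
    exact mul_le_mul_of_nonneg_right this (sq_nonneg _)
  -- `∫|∇w|²_F ≤ C_G R^{1-ρ}`
  have hEgrowth := lintegral_ball_frobenius_le_of_weight hρ1 hE (by positivity : 0 < 3 * R)
  have hAgrowth := hA (3 * R) (by positivity)
  have hDw : ∫⁻ y, ENNReal.ofReal (frobeniusNormSq (Gw y)) ≤
      ENNReal.ofReal ((2 * (3 : ℝ) ^ (1 - ρ) * ((1 - ρ) / (2 + ρ) * c) +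
        6 * M ^ 2 * (3 : ℝ) ^ (1 - 2 * ρ) * c) * R ^ (1 - ρ)) := by
    -- pointwise Leibniz bound, supported in `B`
    have hpt : ∀ y, ENNReal.ofReal (frobeniusNormSq (Gw y)) ≤
        2 * B.indicator (fun y => ENNReal.ofReal (frobeniusNormSq (G y))) y +
          ENNReal.ofReal (6 * (M / R) ^ 2) * B.indicator (fun y => ‖V y‖ₑ ^ 2) y := by
      intro y
      have hL := frobeniusNormSq_smul_add_smulRight_le (χ y) (G y) (fderiv ℝ χ y) (V y)
      by_cases hy : y ∈ B
      · rw [indicator_of_mem hy, indicator_of_mem hy]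
        have hb : frobeniusNormSq (Gw y) ≤ 2 * frobeniusNormSq (G y) + 6 * (M / R) ^ 2 * ‖V y‖ ^ 2 := by
          refine hL.trans ?_
          have hχ2 : χ y ^ 2 ≤ 1 := by nlinarith [(hχ01 y).1, (hχ01 y).2]
          have hf0 : 0 ≤ frobeniusNormSq (G y) := frobeniusNormSq_nonneg _
          have hd2 : ‖fderiv ℝ χ y‖ ^ 2 ≤ (M / R) ^ 2 :=
            pow_le_pow_left₀ (norm_nonneg _) (hDχ y) 2
          nlinarith [sq_nonneg ‖V y‖, norm_nonneg (fderiv ℝ χ y)]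
        calc ENNReal.ofReal (frobeniusNormSq (Gw y))
            ≤ ENNReal.ofReal (2 * frobeniusNormSq (G y) + 6 * (M / R) ^ 2 * ‖V y‖ ^ 2) :=
              ENNReal.ofReal_le_ofReal hb
          _ = 2 * ENNReal.ofReal (frobeniusNormSq (G y)) +
                ENNReal.ofReal (6 * (M / R) ^ 2) * ‖V y‖ₑ ^ 2 := by
              rw [ENNReal.ofReal_add (by positivity [frobeniusNormSq_nonneg (G y)]) (by positivity),
                ENNReal.ofReal_mul (by norm_num), ENNReal.ofReal_ofNat,
                ENNReal.ofReal_mul (by positivity), ← ofReal_norm,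
                ← ENNReal.ofReal_pow (norm_nonneg _)]
      · rw [indicator_of_notMem hy, indicator_of_notMem hy]
        have hG0 : Gw y = 0 := by
          ext v
          simp [hGw, (houtB y hy).1, (houtB y hy).2]
        rw [hG0, frobeniusNormSq_zero]; simp
    calc ∫⁻ y, ENNReal.ofReal (frobeniusNormSq (Gw y))
        ≤ ∫⁻ y, (2 * B.indicator (fun y => ENNReal.ofReal (frobeniusNormSq (G y))) y +
            ENNReal.ofReal (6 * (M / R) ^ 2) * B.indicator (fun y => ‖V y‖ₑ ^ 2) y) :=
          lintegral_mono hpt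
      _ = (2 * ∫⁻ y in B, ENNReal.ofReal (frobeniusNormSq (G y))) +
            ENNReal.ofReal (6 * (M / R) ^ 2) * ∫⁻ y in B, ‖V y‖ₑ ^ 2 := by
          have hm1 : AEMeasurable (fun y => B.indicator (fun y => ENNReal.ofReal (frobeniusNormSq (G y))) y)
              volume :=
            (((continuous_frobeniusNormSq' (E := EuclideanSpace ℝ (Fin 3))).comp_aestronglyMeasurable
              hGm).aemeasurable.ennreal_ofReal).indicator hBm
          have hm2 : AEMeasurable (fun y => B.indicator (fun y => ‖V y‖ₑ ^ 2) y) volume :=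
            (hVm.enorm.pow_const 2).indicator hBm
          rw [lintegral_add_left' (hm1.const_mul _), lintegral_const_mul'' _ hm1,
            lintegral_const_mul'' _ hm2, lintegral_indicator hBm, lintegral_indicator hBm]
      _ ≤ ENNReal.ofReal (2 * ((3 * R) ^ (1 - ρ) * ((1 - ρ) / (2 + ρ) * c))) +
            ENNReal.ofReal (6 * (M / R) ^ 2 * (c * (3 * R) ^ (1 - 2 * ρ))) := by
          have h1ρ : 0 ≤ (1 - ρ) / (2 + ρ) := by
            apply div_nonneg <;> linarith
          have hc0 : (0 : ℝ) ≤ c := c.2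
          -- the two growth bounds in `ofReal` form
          have hE' : ∫⁻ y in B, ENNReal.ofReal (frobeniusNormSq (G y)) ≤
              ENNReal.ofReal ((3 * R) ^ (1 - ρ) * ((1 - ρ) / (2 + ρ) * c)) := by
            refine hEgrowth.trans (le_of_eq ?_)
            rw [ENNReal.ofReal_mul (by positivity), ENNReal.ofReal_mul h1ρ, ENNReal.ofReal_coe_nnreal]
          have hA' : ∫⁻ y in B, ‖V y‖ₑ ^ 2 ≤ ENNReal.ofReal (c * (3 * R) ^ (1 - 2 * ρ)) := by
            refine hAgrowth.trans (le_of_eq ?_)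
            rw [ENNReal.ofReal_mul hc0, ENNReal.ofReal_coe_nnreal]
          have e2 : (2 : ℝ≥0∞) = ENNReal.ofReal 2 := (ENNReal.ofReal_ofNat 2).symm
          refine add_le_add ?_ ?_
          · rw [ENNReal.ofReal_mul (by norm_num : (0:ℝ) ≤ 2), ← e2]
            gcongr
          · rw [ENNReal.ofReal_mul (by positivity : (0:ℝ) ≤ 6 * (M / R) ^ 2)]
            gcongr
      _ = ENNReal.ofReal (2 * ((3 * R) ^ (1 - ρ) * ((1 - ρ) / (2 + ρ) * c)) +
            6 * (M / R) ^ 2 * (c * (3 * R) ^ (1 - 2 * ρ))) := by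
          have h1ρ : 0 ≤ (1 - ρ) / (2 + ρ) := by
            apply div_nonneg <;> linarith
          rw [ENNReal.ofReal_add (by positivity) (by positivity)]
      _ ≤ _ := by
          refine ENNReal.ofReal_le_ofReal ?_
          -- `(3R)^{1-ρ} = 3^{1-ρ} R^{1-ρ}` and `R⁻²(3R)^{1-2ρ} ≤ 3^{1-2ρ} R^{1-ρ}` for `R ≥ 1`
          have e1 : (3 * R) ^ (1 - ρ) = (3 : ℝ) ^ (1 - ρ) * R ^ (1 - ρ) :=
            Real.mul_rpow (by norm_num) hR0.le
          have e2 : (3 * R) ^ (1 - 2 * ρ) = (3 : ℝ) ^ (1 - 2 * ρ) * R ^ (1 - 2 * ρ) :=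
            Real.mul_rpow (by norm_num) hR0.le
          have h3 : (M / R) ^ 2 * R ^ (1 - 2 * ρ) ≤ M ^ 2 * R ^ (1 - ρ) := by
            rw [div_pow, div_mul_eq_mul_div, div_le_iff₀ (by positivity)]
            rw [mul_assoc]
            refine mul_le_mul_of_nonneg_left ?_ (sq_nonneg _)
            rw [show R ^ 2 = R ^ (2 : ℝ) by norm_cast, ← Real.rpow_add hR0]
            exact Real.rpow_le_rpow_of_exponent_le hR (by linarith)
          have h1ρ : 0 ≤ (1 - ρ) / (2 + ρ) := by
            apply div_nonneg <;> linarith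
          rw [e1, e2]
          have hc0 : (0 : ℝ) ≤ c := c.2
          have h33 : 0 ≤ (3 : ℝ) ^ (1 - 2 * ρ) := Real.rpow_nonneg (by norm_num) _
          have hkey : 6 * (M / R) ^ 2 * (c * ((3 : ℝ) ^ (1 - 2 * ρ) * R ^ (1 - 2 * ρ))) ≤
              6 * M ^ 2 * (3 : ℝ) ^ (1 - 2 * ρ) * c * R ^ (1 - ρ) := by
            have := mul_le_mul_of_nonneg_left h3 (mul_nonneg hc0 h33)
            nlinarith [this]
          nlinarith [hkey, Real.rpow_nonneg (by norm_num : (0:ℝ) ≤ 3) (1 - ρ),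
            Real.rpow_nonneg hR0.le (1 - ρ), h1ρ, hc0]
  -- the whole-space interpolation–Sobolev bound for `w`
  have hcube := SereginSverak2002.lintegral_enorm_pow_three_le_of_hasWeakGradient hw2 hwG hAw
  -- `V = w` on `B_R`
  have hVw : ∫⁻ y in ball (0 : EuclideanSpace ℝ (Fin 3)) R, ‖V y‖ₑ ^ (3 : ℕ) =
      ∫⁻ y in ball (0 : EuclideanSpace ℝ (Fin 3)) R, ‖w y‖ₑ ^ (3 : ℕ) := by
    refine setLIntegral_congr_fun measurableSet_ball fun y hy => ?_
    rw [mem_ball, dist_zero_right] at hy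
    rw [hw]; simp only [hχone y hy, one_smul]
  rw [hVw]
  refine (setLIntegral_le_lintegral _ _).trans (hcube.trans ?_)
  gcongr

end CubicBall

end EnergySaturation

end Summit.NavierStokesRegularity.NavierStokesRegularity.Theorems.PowerGaugeEulerLiouville

end
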